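import Summits.Schanuel.Schanuel.Theorems.RootDecomp1KRunge02

/-!
# RootDecomp1KRunge — lens 1, generation 57, NODE 18 «RUNGE ON THE K-LINE» (2-adic Runge's method at x = ∞; RULE K-R48 payable clause; CLAIM L2698, PRICE L2701, K-R49) — continuation (RootDecomp1KRunge03): §6 RungeCert and the engine

(lens-1 g57 NODE 18 HOME kernel K = HOME/decomp-schanuel-lens-1/g57/Runge.lean 42801ffe…, 1394 l, 113 thm + structure RungeCert + integer-table defs, imports tree …RootDecomp1KParamThueMahler03 ONLY = the port of node 17 (no Literature import, no fact def, no private; two local `set_option maxHeartbeats … in` as in K); Probe / Ctrl0 / Ctrl + NODE-g57.md + SHA256SUMS; CLAIM L2698, census LIVENESS-v8 L2699 (of record L2701) / LIVENESS-v9 L2703, writer CHECK NOTE L2700 (certificate arithmetic reproduces), crit g10 EX-ANTE PRICE L2701 (ONE THEOREM ×1 for (A) engine + (B) binder discharge thinFibreAt_M17P + (C) the family RW jointly iff CHECKLIST K-g57 (1)–(10); RULE K-R49 pre-announced), NODE L2704, critic VERDICT L2711 (crit g10): CLEARED — THEOREM ×1 (joint (A) engine + (B) binder discharge + (C) the family RW),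 ex-ante PRICE L2701 met 10/10, prong «infinite class of positive-genus re-amended-frontier pairs made unconditional» (K-R48 PAYABLE), rung 0; RULE K-R49 FIXED (toolkit of record ∪= 2-adic Runge certificates — the `RungeCert k c` engine `thinFibreAt_of_rungeCert`; FRONTIER re-amended by «NOT Runge-certifiable», Runge-certifiable(m₀,P) := ((deg topX < natDegree ∨ topX ℚ-reducible) ∧ eTop+1 ≤ m₀) ∨ natDegree < m₀·xdeg; standing open-territory witness W4 (census TM33)); PORT GO exactly as STAGING NOTE 8 L2708 with the port edits (a)–(d) SANCTIONED; writer RE-CHECK L2709. Port by census-1 gen 22 as `RootDecomp1KRunge01–06` (`--supports stmt-Schanuel-33364`; no census credit): 01 = §0 small facts (local copies of private tree lemmas), §1 integer coefficient tables `ev` / `ev₁` / `tabAbs`, §2 the level polynomial `ptilde` vanishing at (t_N, r) (`tQ N = 2^N!/p_N`); 02 = §3 THE 2-ADIC RUNGE ESTIMATE `runge_small` (‖Φ(t_N, r)‖₂ ≤ K·2^(−M·N!)), §4 the integer `zInt` (product formula), §5 the arithmetic endgame; 03 = §6 `structure RungeCert k c` (integral two-polynomial Runge certificate) and THE ENGINE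 **`thinFibreAt_of_rungeCert`**; 04 = §7 the member M17P: tables `m17G … m17rho`, `m17Cert : RungeCert 2 m17C`, **`thinFibreAt_M17P_runge : 2 ≤ m₀ → ThinFibreAt m₀ M17P` HYPOTHESIS-FREE** (the tree's `thinFibreAt_M17P (hS : PadicSubspace)` loses its binder); 05 = §8 the infinite class `RW w = xPolyP 5 (rwC w)` (deg w ≤ 3), the w-free certificate `rwCert`, **`thinFibreAt_RW`**, members `RW1/RW2/RW3`; 06 = §9 TERRITORY certificates by tree names (section Territory). PORT EDITS (head dry-run near-duplicate notes resolved before filing, as in the node-14/15 ports): TWO delete-for-twin in §0 — K's `partialSum_two_runge` (≡ `RootDecomp1KLevelFinite.lac_partialSum_two`, LevelFinite12) and K's `norm_two_runge` (≡ `RootDecomp1KLocalExponent.norm_two_Cp`, LocalExponent01), each single use re-pointed to the tree name; TWO privatisations with file-local copies where a later part uses them — K's `norm_intCast_le_one_runge` and `norm_intCast_two_runge` (near-duplicates of BirchSwinnertonDyer decls); 62 one-line docstrings on undocumented computation lemmas (statements quoted); K's two local `set_option maxHeartbeats N in` kept verbatim; nothing else; provenance doc blocks + continuation headers = K's own open-lines;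 statements and proofs VERBATIM. Rung 0 — nothing here proves Schanuel, 33364, 33363, 31077 or ThinFibre 2; everything HYPOTHESIS-FREE.)
-/

noncomputable section

namespace Summit.Schanuel.Schanuel.Theorems.RootDecomp1KRunge

open Polynomial LiouvilleNumber
open scoped Nat
open Summit.Schanuel.Schanuel.Theorems.RootDecomp1KTwoBaseCell (psNumer partialSum_eq_psNumer_div coprime_psNumer)
open Summit.Schanuel.Schanuel.Theorems.RootDecomp1KRelLiouvilleCell (partialSum_two_strictMono
  partialSum_two_lt_liouvilleNumber)
open Summit.Schanuel.Schanuel.Theorems.RootDecomp1KDegreeLadder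
open Summit.Schanuel.Schanuel.Theorems.RootDecomp1KXLinearCore
open Summit.Schanuel.Schanuel.Theorems.RootDecomp1KXLinear
open Summit.Schanuel.Schanuel.Theorems.RootDecomp1KXLinearII
open Summit.Schanuel.Schanuel.Theorems.RootDecomp1KXTop
open Summit.Schanuel.Schanuel.Theorems.RootDecomp1KSubspaceBranch

/-! ### §6 Integral Runge certificates and the engine -/

/-- **An integral (two-polynomial) RUNGE CERTIFICATE** for the curve `Σ_{j ≤ k} x^j c_j(Y)` at the near-root place
over `x = ∞`: integer coefficient tables `G, H, R` (a Hensel factorisation `Dg · P~ = G · H + t^M · R` of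
`P~(t, Y) = Σ_j c_j(Y) t^{k-j}` to order `t^M`, `H(0, Y) = h₀` a non-zero constant), two Runge polynomials
`Φ₁, Φ₂` of `t`-degree `≤ a` and `Y`-degree `≤ b` with `DΦ · Φ_i = V_i(t) · G + t^M · E_i`, an elimination
`A · Φ₁ + B · Φ₂ = ρ(t)` over `ℚ` with `ρ ≠ 0`, and the exponent inequality `b + 1 ≤ (M - a) · 2`.
All identities are UNIVERSAL polynomial identities (checked by `ring` for explicit members). -/
structure RungeCert (k : ℕ) (c : ℕ → ℤ[X]) where
  /-- truncation order -/
  M : ℕ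
  /-- `t`-degree bound of the Runge polynomials -/
  a : ℕ
  /-- `Y`-degree bound of the Runge polynomials -/
  b : ℕ
  /-- table sizes -/
  dtG : ℕ
  dyG : ℕ
  dtH : ℕ
  dyH : ℕ
  dtR : ℕ
  dyR : ℕ
  dtE : ℕ
  dyE : ℕ
  dV : ℕ
  dtA : ℕ
  dyA : ℕ
  /-- the Hensel factor lifting the top coefficient -/
  G : Fin dtG → Fin dyG → ℤ
  /-- the complementary Hensel factor (`≡ h₀ mod t`) -/
  H : Fin dtH → Fin dyH → ℤ
  /-- the Hensel remainder -/
  R : Fin dtR → Fin dyR → ℤ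
  /-- first Runge polynomial -/
  Φ₁ : Fin (a + 1) → Fin (b + 1) → ℤ
  /-- second Runge polynomial -/
  Φ₂ : Fin (a + 1) → Fin (b + 1) → ℤ
  /-- multipliers and remainders: `DΦ · Φ_i = V_i · G + t^M · E_i` -/
  V₁ : Fin dV → ℤ
  V₂ : Fin dV → ℤ
  E₁ : Fin dtE → Fin dyE → ℤ
  E₂ : Fin dtE → Fin dyE → ℤ
  /-- elimination cofactors: `A · Φ₁ + B · Φ₂ = ρ(t)` -/
  A : Fin dtA → Fin dyA → ℤ
  B : Fin dtA → Fin dyA → ℤ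
  /-- the eliminant `ρ ∈ ℤ[t]`, non-zero -/
  ρ : ℤ[X]
  /-- integral scalings -/
  Dg : ℤ
  h₀ : ℤ
  DΦ : ℤ
  hh₀ : h₀ ≠ 0
  hDΦ : DΦ ≠ 0
  hρ : ρ ≠ 0
  /-- the Hensel identity `Dg·P~ = G·H + t^M·R` (in every commutative ring) -/
  hGH : ∀ (S : Type) [CommRing S] (t y : S), (Dg : S) * ptilde k c t y = ev G t y * ev H t y + t ^ M * ev R t y
  /-- `H(0, Y) = h₀` is a non-zero constant -/
  hH0 : ∀ (S : Type) [CommRing S] (y : S), ev H (0 : S) y = h₀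
  /-- the Runge congruences `DΦ·Φᵢ = Vᵢ·G + t^M·Eᵢ` -/
  hΦ₁ : ∀ (S : Type) [CommRing S] (t y : S), (DΦ : S) * ev Φ₁ t y = ev₁ V₁ t * ev G t y + t ^ M * ev E₁ t y
  hΦ₂ : ∀ (S : Type) [CommRing S] (t y : S), (DΦ : S) * ev Φ₂ t y = ev₁ V₂ t * ev G t y + t ^ M * ev E₂ t y
  /-- the Bézout identity `A·Φ₁ + B·Φ₂ = ρ(t)` -/
  hAB : ∀ (S : Type) [CommRing S] (t y : S), ev A t y * ev Φ₁ t y + ev B t y * ev Φ₂ t y = aeval t ρ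

/-- A polynomial whose image over `ℚ` is separable is non-zero. -/
theorem ne_zero_of_map_separable_runge {B : ℤ[X]} (hsep : (B.map (Int.castRingHom ℚ)).Separable) : B ≠ 0 := by
  rintro rfl
  rw [Polynomial.map_zero] at hsep
  exact not_separable_zero hsep

set_option maxHeartbeats 800000 in
/-- **THE ENGINE — `ThinFibreAt` BY RUNGE'S METHOD.**  For `P = Σ_{j ≤ k} x^j c_j(Y)` with separable top
coefficient `c_k`, `deg c_j ≤ deg c_k + e` (`j < k`), and an integral Runge certificate: `ThinFibreAt m₀ P` for every
`m₀ ≥ 2` with `m₀ ≥ e + 1`.  NO Diophantine input: the near-root branch is the product formula on the integer `Z`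
(`runge_small` + `zInt_eq_zero_of_small` + `runge_arith`) and the resultant (`rho_levels_finite`); the far branch is
the tree's `near_root_or_at_infinity` / `infinity_arith`. -/
theorem thinFibreAt_of_rungeCert (k : ℕ) (c : ℕ → ℤ[X]) (e : ℕ) (cert : RungeCert k c)
    (hsep : ((c k).map (Int.castRingHom ℚ)).Separable) (hdeg : ∀ j, j < k → (c j).natDegree ≤ (c k).natDegree + e)
    {m₀ : ℕ} (hexp : cert.b + 1 ≤ (cert.M - cert.a) * m₀) (hme : e + 1 ≤ m₀) : ThinFibreAt m₀ (xPolyP k c) := by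
  classical
  have hB : c k ≠ 0 := ne_zero_of_map_separable_runge hsep
  have haM : cert.a ≤ cert.M := by
    by_contra h
    rw [Nat.sub_eq_zero_of_le (by omega : cert.M ≤ cert.a), zero_mul] at hexp
    omega
  have hℓpos : 0 < ‖((c k).leadingCoeff : PadicAlgCl 2)‖ := by
    rw [norm_pos_iff]; exact_mod_cast leadingCoeff_ne_zero.mpr hB
  intro C
  obtain ⟨N₄, hN₄⟩ := infinity_arith ‖((c k).leadingCoeff : PadicAlgCl 2)‖ C hℓpos e
  -- the `(∞, ∞)` end (tree): `‖lc‖·2^{N!} ≤ ‖r‖₂^e ≤ den(r)^e`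
  have hinf : ∀ N, N₄ ≤ N → ∀ r : ℚ,
      ‖((c k).leadingCoeff : PadicAlgCl 2)‖ * 2 ^ N ! ≤ ‖(r : PadicAlgCl 2)‖ ^ e →
      C * 2 ^ (N + 1)! < (r.den : ℝ) ^ (m₀ * N) := by
    intro N hN r hfar
    have hd1 : (1 : ℝ) ≤ r.den := by exact_mod_cast Nat.succ_le_of_lt r.den_pos
    have hfar' : ‖((c k).leadingCoeff : PadicAlgCl 2)‖ * 2 ^ N ! ≤ (r.den : ℝ) ^ e :=
      hfar.trans (pow_le_pow_left₀ (norm_nonneg _) (norm_ratCast_le_den r) e)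
    have h := hN₄ N hN r.den (Nat.succ_le_of_lt r.den_pos) hfar'
    exact h.trans_le (pow_le_pow_right₀ hd1 (Nat.mul_le_mul_right _ hme))
  by_cases hd : 1 ≤ (c k).natDegree
  · obtain ⟨T, cc, N₁, hcc, hTroots, hclose⟩ := near_root_or_at_infinity k c e hd hsep hdeg
    -- the 2-adic window of the near branch
    set Ry : ℝ := 1 + (∑ β ∈ T, ‖β‖) + cc / ‖((c k).leadingCoeff : PadicAlgCl 2)‖ with hRy
    -- the Runge estimates for the two Runge polynomials
    obtain ⟨K₁, hK₁, N₅, hN₅⟩ := runge_small k c cert.G cert.H cert.R cert.E₁ cert.Φ₁ cert.V₁ cert.Dg cert.h₀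
      cert.DΦ cert.hh₀ cert.hDΦ (cert.hGH _) (cert.hH0 _) (cert.hΦ₁ _) Ry
    obtain ⟨K₂, hK₂, N₆, hN₆⟩ := runge_small k c cert.G cert.H cert.R cert.E₂ cert.Φ₂ cert.V₂ cert.Dg cert.h₀
      cert.DΦ cert.hh₀ cert.hDΦ (cert.hGH _) (cert.hH0 _) (cert.hΦ₂ _) Ry
    -- the arithmetic endgame
    set Kar : ℝ := max (K₁ * (tabAbs cert.Φ₁ * 2 ^ cert.a * max 1 C ^ cert.b))
      (K₂ * (tabAbs cert.Φ₂ * 2 ^ cert.a * max 1 C ^ cert.b)) with hKar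
    obtain ⟨N₇, hN₇⟩ := runge_arith Kar C cert.b m₀ cert.M cert.a hexp
    -- the resultant: finitely many levels with `Φ₁(t_N, r) = Φ₂(t_N, r) = 0`
    obtain ⟨N₃, hN₃⟩ := (rho_levels_finite cert.ρ cert.hρ).bddAbove
    refine ⟨max (max N₁ N₄) (max (max N₅ N₆) (max N₇ (N₃ + 1))), fun N hN r hr hP hnd => ?_⟩
    simp only [max_le_iff] at hN
    obtain ⟨⟨hNN₁, hNN₄⟩, ⟨hNN₅, hNN₆⟩, hNN₇, hNN₃⟩ := hN
    rcases hclose N hNN₁ r hP with ⟨β, hβT, hx⟩ | ⟨_, hfar⟩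
    · -- NEAR a root `β` of the top coefficient: Runge
      have hrRy : ‖(r : PadicAlgCl 2)‖ ≤ Ry := by
        have h1 : ‖((c k).leadingCoeff : PadicAlgCl 2) * ((r : PadicAlgCl 2) - β)‖ ≤ cc := by
          refine hx.trans ?_
          have : (1 / 2 : ℝ) ^ N ! ≤ 1 := pow_le_one₀ (by norm_num) (by norm_num)
          nlinarith
        rw [norm_mul] at h1
        have h2 : ‖(r : PadicAlgCl 2) - β‖ ≤ cc / ‖((c k).leadingCoeff : PadicAlgCl 2)‖ := by
          rw [le_div_iff₀ hℓpos, mul_comm]; exact h1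
        have h3 : ‖β‖ ≤ ∑ β ∈ T, ‖β‖ :=
          Finset.single_le_sum (f := fun β => ‖β‖) (fun β _ => norm_nonneg β) hβT
        calc ‖(r : PadicAlgCl 2)‖ = ‖((r : PadicAlgCl 2) - β) + β‖ := by rw [sub_add_cancel]
          _ ≤ ‖(r : PadicAlgCl 2) - β‖ + ‖β‖ := norm_add_le _ _
          _ ≤ cc / ‖((c k).leadingCoeff : PadicAlgCl 2)‖ + ∑ β ∈ T, ‖β‖ := add_le_add h2 h3
          _ ≤ Ry := by rw [hRy]; linarith
      by_contra hcl
      have hd1 : 1 ≤ r.den := Nat.succ_le_of_lt r.den_pos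
      -- both integers `Z₁, Z₂` vanish (else the clause holds)
      have hz₁ : zInt cert.a cert.b cert.Φ₁ N r = 0 := by
        refine zInt_eq_zero_of_small cert.Φ₁ haM hK₁.le hr (hN₅ N hNN₅ r hP hrRy) fun hbig => hcl ?_
        exact hN₇ N hNN₇ r.den hd1 (hbig.trans (mul_le_mul_of_nonneg_right (le_max_left _ _) (by positivity)))
      have hz₂ : zInt cert.a cert.b cert.Φ₂ N r = 0 := by
        refine zInt_eq_zero_of_small cert.Φ₂ haM hK₂.le hr (hN₆ N hNN₆ r hP hrRy) fun hbig => hcl ?_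
        exact hN₇ N hNN₇ r.den hd1 (hbig.trans (mul_le_mul_of_nonneg_right (le_max_right _ _) (by positivity)))
      -- hence `Φ₁(t_N, r) = Φ₂(t_N, r) = 0` in `ℚ`
      have hp : (psNumer 2 N : PadicAlgCl 2) ≠ 0 := by exact_mod_cast (psNumer_pos_runge N).ne'
      have hdC : (r.den : PadicAlgCl 2) ≠ 0 := by exact_mod_cast r.den_nz
      have hΦ0 : ∀ Φ : Fin (cert.a + 1) → Fin (cert.b + 1) → ℤ, zInt cert.a cert.b Φ N r = 0 →
          ev Φ (tQ N) r = 0 := by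
        intro Φ hz
        have h1 := zInt_castTwo cert.a cert.b Φ N r
        rw [hz, Int.cast_zero] at h1
        have h2 : ev Φ ((2 : PadicAlgCl 2) ^ N ! / (psNumer 2 N : PadicAlgCl 2)) (r : PadicAlgCl 2) = 0 := by
          rcases mul_eq_zero.mp h1.symm with h | h
          · rcases mul_eq_zero.mp h with h' | h'
            · exact absurd (pow_eq_zero_iff'.mp h').1 hp
            · exact absurd (pow_eq_zero_iff'.mp h').1 hdC
          · exact h
        have h3 : ((ev Φ (tQ N) r : ℚ) : PadicAlgCl 2) = 0 := by rw [ev_castTwo, tQ_castTwo]; exact h2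
        exact_mod_cast h3
      have hρ0 : aeval (tQ N) cert.ρ = 0 := by
        rw [← cert.hAB ℚ (tQ N) r, hΦ0 cert.Φ₁ hz₁, hΦ0 cert.Φ₂ hz₂, mul_zero, mul_zero, add_zero]
      have hmem : N ∈ {N : ℕ | aeval (tQ N) cert.ρ = 0} := hρ0
      have := hN₃ hmem
      omega
    · exact hinf N hNN₄ r hfar
  · -- constant (non-zero) top coefficient: only the `(∞, ∞)` alternative
    have hd0 : (c k).natDegree = 0 := by omega
    obtain ⟨N₁, hN₁⟩ := at_infinity_of_const_top k c e hB hd0 hdeg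
    refine ⟨max N₁ N₄, fun N hN r _ hP _ => ?_⟩
    obtain ⟨_, hfar⟩ := hN₁ N (le_trans (le_max_left _ _) hN) r hP
    exact hinf N (le_trans (le_max_right _ _) hN) r hfar

end Summit.Schanuel.Schanuel.Theorems.RootDecomp1KRunge

end
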